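import Summits.NavierStokesRegularity.NavierStokesRegularity.Theses.TypeICertificateLadder
import Summits.NavierStokesRegularity.NavierStokesRegularity.Theorems.SqueezeCycleExtremalBiaxialitySubcriticalGaugeStrainBound
import Summits.NavierStokesRegularity.NavierStokesRegularity.Theorems.SqueezeCycleExtremalElementExistsRegularity
import Summits.NavierStokesRegularity.NavierStokesRegularity.Theorems.SqueezeCycleExtremalElementExistsRescale
import Summits.NavierStokesRegularity.NavierStokesRegularity.Theorems.RellichScarSymmetricScarExistsGaussianWindowLawLemmas
import Literature.Analysis.FluidPDE.TypeIAncientMildClassical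
import Literature.Analysis.FluidPDE.AncientSimilarityVariables
import Literature.Analysis.FluidPDE.CaloricRemainderCalculus
import Literature.Analysis.FluidPDE.SpaceTimeCalculus
import Literature.Analysis.FluidPDE.EnstrophySplitting
import Literature.Analysis.FluidPDE.ClassicalSolutionGlue

/-!
# Crux `NoTypeIBlowup` (stmt-NavierStokesRegularity-1217), line `head-flux-channel`:
  stub S2b `stub_gaussianChannelContinuous` — CANDIDATE PROOF (drefute gen-4 side-product)

`Ch(s) = ∫ (½‖U‖² + P)⟪y, U⟫ e^{−‖y‖²/4} dy` is continuous in `s`, for `U = lerayOrbit u`,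
`P = lerayOrbitPressure p`, `u` a Type-I ancient mild field with constant `C` and `p` ANY classical
pressure of `u` on `(−∞, 0)`. Ingredients, all accepted tree facts:

* the three CLASS-UNIFORM KNSS gauge bounds `(−t)‖∇u‖ ≤ K₀`, `√(−t)³‖Δu‖ ≤ K₂`,
  `√(−t)³‖∂ₜu‖ ≤ L` — `exists_gauge_norm_fderiv_le_of_typeI` (accepted, GaugeStrainBound) and
  VERBATIM COPIES of `exists_gauge_norm_laplacian_le_of_typeI`, `exists_gauge_norm_timeDeriv_le_of_typeI`
  from the accepted `Theorems/SymmetryModuliCountLinearLiouvilleSevenGaugeBounds.lean` (copied,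
  not imported, only because that module was not yet built on the farm at writing time — when
  landing, IMPORT it and delete the two copies); whence for ANY classical pressure
  `√(−t)³‖∇p(t, x)‖ ≤ K₂ + L + K₀ C` (`∇p = Δu − ∂ₜu − (u·∇)u`);
* `gradient_lerayOrbitPressure`: `∇P(s)(y) = e^{−3s/2} ∇p(t)(x)`, so `‖∇P‖ ≤ C₃` GLOBALLY, and by
  the mean value inequality `|P(s, y)| ≤ |P(s, 0)| + C₃‖y‖` (LINEAR GROWTH, locally uniform);
* joint smoothness of `U`, `P` on `ℝ × ℝ³` (`isClassicalNSSolutionOn_Iio_iff_isBackwardLeraySolutionOn`),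
  `‖U‖ ≤ C`, and `continuousAt_of_dominated` with the bound `M (1 + ‖y‖)² e^{−‖y‖²/4}` for
  `s ∈ [s₀ − 1, s₀ + 1]` (`M` from a bound of the continuous `s ↦ |P(s, 0)|` there).

The theorem `gaussianChannelContinuous` below has EXACTLY the type of the skeleton stub (checked
by the final `example`). For the lead to land `--supports stmt-NavierStokesRegularity-1217`.
-/

noncomputable section

namespace Summit.NavierStokesRegularity.NavierStokesRegularity.Cruxes.Target.HeadFluxChannelS2b

set_option linter.dupNamespace false

open MeasureTheory Set Filter Topology Function
open scoped RealInnerProductSpace Laplacian ContDiff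
open Literature.Analysis Literature.Analysis.FluidPDE
open Literature.Analysis.FluidPDE.PineauVicol2026
open Summit.NavierStokesRegularity.NavierStokesRegularity.Theorems
open Summit.NavierStokesRegularity.NavierStokesRegularity.Theorems.SymmetricScarExists.LogtimeBernoulli

/-! ### Two class-uniform gauge bounds (verbatim copies, see the module docstring) -/

/-- COPY of `Theorems.exists_gauge_norm_laplacian_le_of_typeI` (accepted, GaugeBounds.lean):
`√(−t)³ ‖Δu(t)(x)‖ ≤ K₂(C)` on the class. [cite: KochNadirashviliSereginSverak2009, Prop. 4.1 (4.10) with k = 2 (arXiv:0709.3599 p. 8)] -/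
theorem gauge_norm_laplacian_le (C : ℝ) :
    ∃ K₂ : ℝ, ∀ ⦃u : ℝ → EuclideanSpace ℝ (Fin 3) → EuclideanSpace ℝ (Fin 3)⦄,
      IsTypeIAncientMild C u → ∀ t < 0, ∀ x, Real.sqrt (-t) ^ 3 * ‖(Δ (u t)) x‖ ≤ K₂ := by
  obtain ⟨K, hK⟩ := exists_norm_iteratedFDeriv_le_of_typeI C 2 (a := -3) (b := -(1 / 2))
    (δ := 1) (by norm_num) (by norm_num) one_pos
  refine ⟨3 * K, fun u hu t ht x => ?_⟩
  set c : ℝ := Real.sqrt (-t) with hcdef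
  have hc : 0 < c := Real.sqrt_pos.2 (neg_pos.2 ht)
  have hc2 : c ^ 2 = -t := Real.sq_sqrt (neg_pos.2 ht).le
  have ht1 : (0 : ℝ) + c ^ 2 * (-1) = t := by rw [hc2]; ring
  have hw : IsTypeIAncientMild C (c • stPull (c ^ 2) c 0 x u) := isTypeIAncientMild_zoom hu hc x
  have h := hK hw.continuousOn_uncurry (fun s hs => hw.isWeaklyDivFree hs)
    (fun s r hsr hr y => hw.mild_eq_heatExtension hsr hr y) hw.hasTypeITimeDecay (-1)
    ⟨by norm_num, by norm_num⟩ 0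
  have hw2 : ContDiff ℝ 2 ((c • stPull (c ^ 2) c 0 x u) (-1)) :=
    (hw.contDiff_slice (by norm_num)).of_le (by norm_cast)
  have hΔw := (norm_laplacian_le_three_mul_norm_iteratedFDeriv_two hw2 0).trans
    (mul_le_mul_of_nonneg_left h (by norm_num))
  have hut2 : ContDiff ℝ 2 (u (0 + c ^ 2 * (-1))) := by
    rw [ht1]; exact (hu.contDiff_slice ht).of_le (by norm_cast)
  have hst2 : ContDiff ℝ 2 (stPull (c ^ 2) c 0 x u (-1)) := by
    have e : stPull (c ^ 2) c 0 x u (-1) = fun y => u (0 + c ^ 2 * (-1)) (x + c • y) := rfl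
    rw [e]
    exact hut2.comp (contDiff_const.add (contDiff_id.const_smul c))
  have key : (Δ ((c • stPull (c ^ 2) c 0 x u) (-1))) 0 = c ^ 3 • (Δ (u t)) x := by
    rw [show (c • stPull (c ^ 2) c 0 x u) (-1) = c • stPull (c ^ 2) c 0 x u (-1) from rfl,
      InnerProductSpace.laplacian_smul c hst2.contDiffAt, laplacian_stPull _ _ _ _ _ _ _ hut2,
      ht1, smul_zero, add_zero, smul_smul]
    ring_nf
  rw [key, norm_smul, Real.norm_of_nonneg (by positivity)] at hΔw
  exact hΔw

/-- COPY of `Theorems.exists_gauge_norm_timeDeriv_le_of_typeI` (accepted, GaugeBounds.lean):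
`√(−t)³ ‖∂ₜu(t, x)‖ ≤ L(C)` on the class. [cite: KochNadirashviliSereginSverak2009, Prop. 4.1 (4.11) with k = 0 (arXiv:0709.3599 p. 8)] -/
theorem gauge_norm_timeDeriv_le (C : ℝ) :
    ∃ L : ℝ, ∀ ⦃u : ℝ → EuclideanSpace ℝ (Fin 3) → EuclideanSpace ℝ (Fin 3)⦄,
      IsTypeIAncientMild C u → ∀ t < 0, ∀ x, Real.sqrt (-t) ^ 3 * ‖timeDeriv u t x‖ ≤ L := by
  obtain ⟨L, hL0, hL⟩ := exists_lipschitz_time_of_typeI C 0 (a := -3) (b := -(1 / 2)) (δ := 1)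
    (by norm_num) (by norm_num) one_pos
  refine ⟨L, fun u hu t ht x => ?_⟩
  set c : ℝ := Real.sqrt (-t) with hcdef
  have hc : 0 < c := Real.sqrt_pos.2 (neg_pos.2 ht)
  have hc2 : c ^ 2 = -t := Real.sq_sqrt (neg_pos.2 ht).le
  have ht1 : (0 : ℝ) + c ^ 2 * (-1) = t := by rw [hc2]; ring
  set w : ℝ → EuclideanSpace ℝ (Fin 3) → EuclideanSpace ℝ (Fin 3) := c • stPull (c ^ 2) c 0 x u
    with hwdef
  have hw : IsTypeIAncientMild C w := isTypeIAncientMild_zoom hu hc x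
  have hlip : ∀ s ∈ Ico (-2 : ℝ) (-(1 / 2)), ‖w s 0 - w (-1) 0‖ ≤ L * ‖s - (-1)‖ := by
    intro s hs
    have h := hL hw.continuousOn_uncurry (fun s hs => hw.isWeaklyDivFree hs)
      (fun s r hsr hr y => hw.mild_eq_heatExtension hsr hr y) hw.hasTypeITimeDecay (-1)
      ⟨by norm_num, by norm_num⟩ s ⟨by linarith [hs.1], by linarith [hs.2]⟩ 0
    have e : ‖iteratedFDeriv ℝ 0 (w s) 0 - iteratedFDeriv ℝ 0 (w (-1)) 0‖ = ‖w s 0 - w (-1) 0‖ := by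
      rw [iteratedFDeriv_zero_eq_comp, iteratedFDeriv_zero_eq_comp, Function.comp_apply,
        Function.comp_apply, ← map_sub, LinearIsometryEquiv.norm_map]
    rw [e, ← Real.norm_eq_abs] at h
    exact h
  have hder : ‖deriv (fun s => w s 0) (-1)‖ ≤ L := by
    refine norm_deriv_le_of_lip' hL0 ?_
    filter_upwards [Ico_mem_nhds (show (-2 : ℝ) < -1 by norm_num)
      (show (-1 : ℝ) < -(1 / 2) by norm_num)] with s hs
    exact hlip s hs
  have huS : IsSmoothSpaceTimeOn (Iio 0) u := hu.contDiffOn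
  have hdiffu : DifferentiableAt ℝ (fun r => u r (x + c • (0 : EuclideanSpace ℝ (Fin 3))))
      (0 + c ^ 2 * (-1)) := by
    rw [ht1]
    exact (huS.differentiableWithinAt_time ht _).differentiableAt (Iio_mem_nhds ht)
  have hdiffst : DifferentiableAt ℝ (fun s => stPull (c ^ 2) c 0 x u s 0) (-1) := by
    have e : (fun s => stPull (c ^ 2) c 0 x u s 0) =
        (fun r => u r (x + c • (0 : EuclideanSpace ℝ (Fin 3)))) ∘ fun s : ℝ => 0 + c ^ 2 * s := rfl
    rw [e]
    exact hdiffu.comp (-1) ((differentiableAt_const _).add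
      ((differentiableAt_const _).mul differentiableAt_id))
  have key : deriv (fun s => w s 0) (-1) = c ^ 3 • timeDeriv u t x := by
    have e : (fun s => w s 0) = fun s => c • stPull (c ^ 2) c 0 x u s 0 := rfl
    rw [e, deriv_fun_const_smul c hdiffst, ← timeDeriv_apply (stPull (c ^ 2) c 0 x u) (-1) 0,
      timeDeriv_stPull, ht1, smul_zero, add_zero, smul_smul]
    ring_nf
  rw [key, norm_smul, Real.norm_of_nonneg (by positivity)] at hder
  exact hder

/-! ### Pressure-gradient bound for ANY classical pressure; linear growth in similarity variables -/

/-- **Scale-invariant pressure-gradient bound for ANY classical pressure of a class member**: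
`√(−t)³ ‖∇p(t, x)‖ ≤ K₂ + L + K₀ C` (`∇p = Δu − ∂ₜu − (u·∇)u` and the three class-uniform gauge
bounds; the computation of `exists_gaugePair_of_typeI`, for a GIVEN pressure). [cite: KochNadirashviliSereginSverak2009, Prop. 4.1 (4.10)–(4.11) (arXiv:0709.3599 p. 8)] -/
theorem exists_norm_gradient_pressure_le {C : ℝ}
    {u : ℝ → EuclideanSpace ℝ (Fin 3) → EuclideanSpace ℝ (Fin 3)}
    {p : ℝ → EuclideanSpace ℝ (Fin 3) → ℝ} (hu : IsTypeIAncientMild C u)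
    (hp : IsClassicalNSSolutionOn (Iio 0) 1 0 u p) :
    ∃ C₃ : ℝ, ∀ t < 0, ∀ x, Real.sqrt (-t) ^ 3 * ‖gradient (p t) x‖ ≤ C₃ := by
  obtain ⟨K₀, hK₀⟩ := exists_gauge_norm_fderiv_le_of_typeI C
  obtain ⟨K₂, hK₂⟩ := gauge_norm_laplacian_le C
  obtain ⟨L, hL⟩ := gauge_norm_timeDeriv_le C
  refine ⟨K₂ + L + K₀ * C, fun t ht x => ?_⟩
  have hmom : timeDeriv u t x + convect (u t) (u t) x = (Δ (u t)) x - gradient (p t) x := by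
    have h := hp.momentum t ht x
    rw [timeDerivWithin_eq_deriv isOpen_Iio ht, ← timeDeriv_apply, one_smul, Pi.zero_apply,
      Pi.zero_apply, add_zero] at h
    exact h
  have hnt : 0 < -t := neg_pos.2 ht
  have hst : 0 < Real.sqrt (-t) := Real.sqrt_pos.2 hnt
  have hs3 : 0 < Real.sqrt (-t) ^ 3 := by positivity
  have hsq : Real.sqrt (-t) ^ 2 = -t := Real.sq_sqrt hnt.le
  have hs3eq : Real.sqrt (-t) ^ 3 = (-t) * Real.sqrt (-t) := by rw [pow_succ, hsq]
  have e : gradient (p t) x = (Δ (u t)) x - timeDeriv u t x - convect (u t) (u t) x := by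
    rw [sub_sub, hmom]; abel
  have h1 : Real.sqrt (-t) ^ 3 * ‖(Δ (u t)) x‖ ≤ K₂ := hK₂ hu t ht x
  have h2 : Real.sqrt (-t) ^ 3 * ‖timeDeriv u t x‖ ≤ L := hL hu t ht x
  have h3 : Real.sqrt (-t) ^ 3 * ‖convect (u t) (u t) x‖ ≤ K₀ * C := by
    have hDu : (-t) * ‖fderiv ℝ (u t) x‖ ≤ K₀ := hK₀ hu t ht x
    have hu0 : ‖u t x‖ ≤ C / Real.sqrt (-t) := hu.norm_le ht x
    have hu1 : Real.sqrt (-t) * ‖u t x‖ ≤ C := by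
      rw [le_div_iff₀ hst] at hu0
      linarith [mul_comm (Real.sqrt (-t)) ‖u t x‖]
    have hK00 : 0 ≤ K₀ := (mul_nonneg hnt.le (norm_nonneg _)).trans hDu
    calc Real.sqrt (-t) ^ 3 * ‖convect (u t) (u t) x‖
        = Real.sqrt (-t) ^ 3 * ‖fderiv ℝ (u t) x (u t x)‖ := by rw [convect_apply]
      _ ≤ Real.sqrt (-t) ^ 3 * (‖fderiv ℝ (u t) x‖ * ‖u t x‖) :=
          mul_le_mul_of_nonneg_left (ContinuousLinearMap.le_opNorm _ _) hs3.le
      _ = ((-t) * ‖fderiv ℝ (u t) x‖) * (Real.sqrt (-t) * ‖u t x‖) := by rw [hs3eq]; ring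
      _ ≤ K₀ * C := mul_le_mul hDu hu1 (by positivity) hK00
  have hnorm : ‖gradient (p t) x‖ ≤
      ‖(Δ (u t)) x‖ + ‖timeDeriv u t x‖ + ‖convect (u t) (u t) x‖ := by
    rw [e]; exact (norm_sub_le _ _).trans (add_le_add (norm_sub_le _ _) le_rfl)
  have hmul := mul_le_mul_of_nonneg_left hnorm hs3.le
  rw [mul_add, mul_add] at hmul
  linarith

/-- **Global gradient bound for the similarity pressure**: `‖∇P(s)(y)‖ ≤ C₃` for
`P = lerayOrbitPressure p` (`∇P(s)(y) = e^{−3s/2} ∇p(−e^{−s})(e^{−s/2}y)`,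
`gradient_lerayOrbitPressure`, `e^{−3s/2} = √(−t)³`). [folklore] -/
theorem exists_norm_gradient_lerayOrbitPressure_le {C : ℝ}
    {u : ℝ → EuclideanSpace ℝ (Fin 3) → EuclideanSpace ℝ (Fin 3)}
    {p : ℝ → EuclideanSpace ℝ (Fin 3) → ℝ} (hu : IsTypeIAncientMild C u)
    (hp : IsClassicalNSSolutionOn (Iio 0) 1 0 u p) :
    ∃ C₃ : ℝ, 0 ≤ C₃ ∧ ∀ s y, ‖gradient (lerayOrbitPressure p s) y‖ ≤ C₃ := by
  obtain ⟨C₃, hC₃⟩ := exists_norm_gradient_pressure_le hu hp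
  refine ⟨C₃, ?_, fun s y => ?_⟩
  · have h := hC₃ (-1) (by norm_num) 0
    exact (mul_nonneg (by positivity) (norm_nonneg _)).trans h
  · have ht : -Real.exp (-s) < 0 := neg_neg_of_pos (Real.exp_pos _)
    have h := hC₃ _ ht (Real.exp (-s / 2) • y)
    rw [neg_neg, sqrt_exp_neg] at h
    rw [gradient_lerayOrbitPressure, lerayOrbitForce_apply, norm_smul,
      Real.norm_of_nonneg (by positivity)]
    exact h

/-- **Linear growth of the similarity pressure**: `|P(s, y)| ≤ |P(s, 0)| + C₃ ‖y‖`
(mean value inequality with the global gradient bound). [folklore] -/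
theorem abs_lerayOrbitPressure_le {C : ℝ}
    {u : ℝ → EuclideanSpace ℝ (Fin 3) → EuclideanSpace ℝ (Fin 3)}
    {p : ℝ → EuclideanSpace ℝ (Fin 3) → ℝ} (hu : IsTypeIAncientMild C u)
    (hp : IsClassicalNSSolutionOn (Iio 0) 1 0 u p) :
    ∃ C₃ : ℝ, 0 ≤ C₃ ∧ ∀ s y,
      |lerayOrbitPressure p s y| ≤ |lerayOrbitPressure p s 0| + C₃ * ‖y‖ := by
  obtain ⟨C₃, hC₃0, hC₃⟩ := exists_norm_gradient_lerayOrbitPressure_le hu hp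
  have hP : IsSmoothSpaceTimeOn univ (lerayOrbitPressure p) :=
    (isClassicalNSSolutionOn_Iio_iff_isBackwardLeraySolutionOn.1 hp).smooth_pressure
  refine ⟨C₃, hC₃0, fun s y => ?_⟩
  have hd : ∀ z ∈ (univ : Set (EuclideanSpace ℝ (Fin 3))),
      DifferentiableAt ℝ (lerayOrbitPressure p s) z := fun z _ =>
    ((hP.contDiff_slice (mem_univ s)).differentiable (by simp)).differentiableAt
  have hb : ∀ z ∈ (univ : Set (EuclideanSpace ℝ (Fin 3))),
      ‖fderiv ℝ (lerayOrbitPressure p s) z‖ ≤ C₃ := fun z _ => by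
    have e : ‖gradient (lerayOrbitPressure p s) z‖ = ‖fderiv ℝ (lerayOrbitPressure p s) z‖ := by
      rw [gradient, LinearIsometryEquiv.norm_map]
    rw [← e]; exact hC₃ s z
  have hmv := Convex.norm_image_sub_le_of_norm_fderiv_le hd hb convex_univ (mem_univ 0) (mem_univ y)
  rw [sub_zero, Real.norm_eq_abs] at hmv
  have htri : |lerayOrbitPressure p s y| ≤
      |lerayOrbitPressure p s 0| + |lerayOrbitPressure p s y - lerayOrbitPressure p s 0| := by
    have := abs_add_le (lerayOrbitPressure p s 0) (lerayOrbitPressure p s y - lerayOrbitPressure p s 0)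
    rwa [add_sub_cancel] at this
  linarith

/-- `‖U(s, y)‖ ≤ C` for `U = lerayOrbit u`, `u` in the class (copy of the tree's
`mustSqueeze_norm_lerayOrbit_le`). [folklore] -/
theorem norm_lerayOrbit_le {C : ℝ} {u : ℝ → EuclideanSpace ℝ (Fin 3) → EuclideanSpace ℝ (Fin 3)}
    (h : IsTypeIAncientMild C u) (s : ℝ) (y : EuclideanSpace ℝ (Fin 3)) :
    ‖lerayOrbit u s y‖ ≤ C := by
  have hpos : 0 < Real.exp (-s / 2) := Real.exp_pos _
  have key := h.norm_le (t := -Real.exp (-s)) (by simpa using Real.exp_pos (-s))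
    (Real.exp (-s / 2) • y)
  rw [neg_neg, sqrt_exp_neg] at key
  rw [lerayOrbit_apply, norm_smul, Real.norm_of_nonneg hpos.le]
  calc Real.exp (-s / 2) * ‖u (-Real.exp (-s)) (Real.exp (-s / 2) • y)‖
      ≤ Real.exp (-s / 2) * (C / Real.exp (-s / 2)) := by gcongr
    _ = C := by field_simp

/-! ### The abstract continuity statement and S2b -/

/-- **Continuity of the head-flux channel for bounded `U` and linearly growing `P`**, both
jointly smooth on `ℝ × ℝ³`: dominated convergence locally in `s` with the bound
`M (1 + ‖y‖)² e^{−‖y‖²/4}`. [folklore] -/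
theorem continuous_channel_of_linearGrowth
    {U : ℝ → EuclideanSpace ℝ (Fin 3) → EuclideanSpace ℝ (Fin 3)}
    {P : ℝ → EuclideanSpace ℝ (Fin 3) → ℝ}
    (hU : IsSmoothSpaceTimeOn univ U) (hP : IsSmoothSpaceTimeOn univ P) {C C₃ : ℝ}
    (hC : 0 ≤ C) (hC₃ : 0 ≤ C₃) (hUC : ∀ s y, ‖U s y‖ ≤ C)
    (hlin : ∀ s y, |P s y| ≤ |P s 0| + C₃ * ‖y‖) :
    Continuous (fun s : ℝ =>
      ∫ y, (‖U s y‖ ^ 2 / 2 + P s y) * ⟪y, U s y⟫ * Real.exp (-‖y‖ ^ 2 / 4)) := by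
  have hmeas : ∀ s, AEStronglyMeasurable
      (fun y => (‖U s y‖ ^ 2 / 2 + P s y) * ⟪y, U s y⟫ * Real.exp (-‖y‖ ^ 2 / 4)) volume := by
    intro s
    have cU : Continuous (U s) := (hU.contDiff_slice (mem_univ s)).continuous
    have cP : Continuous (P s) := (hP.contDiff_slice (mem_univ s)).continuous
    have cG : Continuous fun y : EuclideanSpace ℝ (Fin 3) => Real.exp (-‖y‖ ^ 2 / 4) :=
      continuous_gaussWeight
    exact ((((cU.norm.pow 2).div_const 2).add cP).mul (continuous_id.inner cU)).mul cG
      |>.aestronglyMeasurable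
  have hcont : ∀ y, Continuous fun s =>
      (‖U s y‖ ^ 2 / 2 + P s y) * ⟪y, U s y⟫ * Real.exp (-‖y‖ ^ 2 / 4) := by
    intro y
    have cU : Continuous fun s => U s y := continuous_timeLine hU y
    have cP : Continuous fun s => P s y := continuous_timeLine hP y
    exact ((((cU.norm.pow 2).div_const 2).add cP).mul (continuous_const.inner cU)).mul
      continuous_const
  refine continuous_iff_continuousAt.2 fun s₀ => ?_
  -- a bound for `|P(s, 0)|` on `[s₀ - 1, s₀ + 1]`
  obtain ⟨M₀, hM₀⟩ := (isCompact_Icc (a := s₀ - 1) (b := s₀ + 1)).exists_bound_of_continuousOn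
    ((continuous_timeLine hP (0 : EuclideanSpace ℝ (Fin 3))).continuousOn)
  have hM₀0 : 0 ≤ M₀ := (norm_nonneg _).trans (hM₀ s₀ ⟨by linarith, by linarith⟩)
  -- the domination on the neighbourhood
  have hdom : ∀ s ∈ Icc (s₀ - 1) (s₀ + 1), ∀ y,
      ‖(‖U s y‖ ^ 2 / 2 + P s y) * ⟪y, U s y⟫ * Real.exp (-‖y‖ ^ 2 / 4)‖ ≤
        (C ^ 2 / 2 + M₀ + C₃) * C * (1 + ‖y‖) ^ 2 * gaussWeight y := by
    intro s hs y
    have hy0 : 0 ≤ ‖y‖ := norm_nonneg y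
    have hg0 : 0 < gaussWeight y := gaussWeight_pos y
    have hUy : ‖U s y‖ ≤ C := hUC s y
    have hP0 : |P s 0| ≤ M₀ := by
      have h := hM₀ s hs
      rwa [Real.norm_eq_abs] at h
    have hPy : |P s y| ≤ M₀ + C₃ * ‖y‖ := (hlin s y).trans (by linarith)
    have hhead : |‖U s y‖ ^ 2 / 2 + P s y| ≤ (C ^ 2 / 2 + M₀ + C₃) * (1 + ‖y‖) := by
      have h1 : |‖U s y‖ ^ 2 / 2| ≤ C ^ 2 / 2 := by
        rw [abs_of_nonneg (by positivity)]
        have := pow_le_pow_left₀ (norm_nonneg _) hUy 2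
        linarith
      have h2 := (abs_add_le _ _).trans (add_le_add h1 hPy)
      have h3 : C ^ 2 / 2 + (M₀ + C₃ * ‖y‖) ≤ (C ^ 2 / 2 + M₀ + C₃) * (1 + ‖y‖) := by
        nlinarith [sq_nonneg C, hM₀0, hC₃, hy0]
      exact h2.trans h3
    have hinner : |⟪y, U s y⟫| ≤ (1 + ‖y‖) * C :=
      (abs_real_inner_le_norm _ _).trans
        (mul_le_mul (by linarith) hUy (norm_nonneg _) (by positivity))
    rw [Real.norm_eq_abs, abs_mul, abs_mul, abs_of_pos (Real.exp_pos _)]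
    have hprod := mul_le_mul hhead hinner (abs_nonneg _) (by positivity)
    calc |‖U s y‖ ^ 2 / 2 + P s y| * |⟪y, U s y⟫| * Real.exp (-‖y‖ ^ 2 / 4)
        ≤ ((C ^ 2 / 2 + M₀ + C₃) * (1 + ‖y‖)) * ((1 + ‖y‖) * C) * Real.exp (-‖y‖ ^ 2 / 4) :=
          mul_le_mul_of_nonneg_right hprod (Real.exp_pos _).le
      _ = (C ^ 2 / 2 + M₀ + C₃) * C * (1 + ‖y‖) ^ 2 * gaussWeight y := by
          rw [gaussWeight]; ring
  refine continuousAt_of_dominated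
    (bound := fun y => (C ^ 2 / 2 + M₀ + C₃) * C * (1 + ‖y‖) ^ 2 * gaussWeight y)
    (Eventually.of_forall hmeas) ?_ ?_ (Eventually.of_forall fun y => (hcont y).continuousAt)
  · filter_upwards [Icc_mem_nhds (show s₀ - 1 < s₀ by linarith) (show s₀ < s₀ + 1 by linarith)]
      with s hs
    exact Eventually.of_forall (hdom s hs)
  · refine integrable_of_norm_le_mul_gaussWeight (M := (C ^ 2 / 2 + M₀ + C₃) * C) ?_ 2
      fun y => ?_
    · exact ((continuous_const.mul ((continuous_const.add continuous_norm).pow 2)).mul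
        continuous_gaussWeight).aestronglyMeasurable
    · rw [Real.norm_of_nonneg]
      have := gaussWeight_pos y
      positivity

/-- **S2b — continuity of the head-flux channel** `s ↦ ∫ (½‖U‖² + P)⟪y, U⟫ e^{−‖y‖²/4}` along
the Leray orbit of a Type-I ancient mild field with ANY classical pressure on `(−∞, 0)`
(the verbatim stub of `Cruxes/Target/Lines/head-flux-channel.lean`). [folklore] -/
theorem gaussianChannelContinuous :
    ∀ (C : ℝ) (u : ℝ → EuclideanSpace ℝ (Fin 3) → EuclideanSpace ℝ (Fin 3))
      (p : ℝ → EuclideanSpace ℝ (Fin 3) → ℝ),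
      IsTypeIAncientMild C u → IsClassicalNSSolutionOn (Set.Iio 0) 1 0 u p →
      Continuous (fun s : ℝ =>
          ∫ y, (‖lerayOrbit u s y‖ ^ 2 / 2 + lerayOrbitPressure p s y) *
            ⟪y, lerayOrbit u s y⟫ * Real.exp (-‖y‖ ^ 2 / 4)) := by
  intro C u p hu hp
  have hBL := isClassicalNSSolutionOn_Iio_iff_isBackwardLeraySolutionOn.1 hp
  obtain ⟨C₃, hC₃0, hlin⟩ := abs_lerayOrbitPressure_le hu hp
  exact continuous_channel_of_linearGrowth hBL.smooth_velocity hBL.smooth_pressure hu.nonneg hC₃0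
    (norm_lerayOrbit_le hu) hlin

/-- The theorem has exactly the type of the skeleton stub `stub_gaussianChannelContinuous`. -/
example :
    ∀ (C : ℝ) (u : ℝ → EuclideanSpace ℝ (Fin 3) → EuclideanSpace ℝ (Fin 3))
      (p : ℝ → EuclideanSpace ℝ (Fin 3) → ℝ),
      IsTypeIAncientMild C u → IsClassicalNSSolutionOn (Set.Iio 0) 1 0 u p →
      Continuous (fun s : ℝ =>
          ∫ y, (‖lerayOrbit u s y‖ ^ 2 / 2 + lerayOrbitPressure p s y) *
            ⟪y, lerayOrbit u s y⟫ * Real.exp (-‖y‖ ^ 2 / 4)) :=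
  gaussianChannelContinuous

end Summit.NavierStokesRegularity.NavierStokesRegularity.Cruxes.Target.HeadFluxChannelS2b

end
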